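import Summits.QuantumFields.YangMills.Theorems.BalabanUVNodesN15CurvedTransporterOrthogonality
import Summits.QuantumFields.YangMills.Theorems.BalabanUVNodesN15CurvedDressedPair
import HarnessLib

/-!
# Route «BalabanUVNodes» (cluster K4 «SpineRates»), Track-A DAG node N15 = NE2, BACKGROUND LAYER AT CURVED `U` — THE CURVED DRESSED PAIR FOR BAŁABAN's EXPONENTIAL
# SPECIES WITH NO ORTHOGONALITY HYPOTHESIS: dag-n15-w3 file 2's four headlines (resolvent certificate, Neumann unit, dressed majorant, background-Lipschitz increment)
# at `S = coordMat e (e^{ηZ})`, `R = coordMat e (e^{ηW})` with the transporter letters READ OFF the generator letters and the orthogonality SUPPLIED by skewness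

Cell `pub-ymgap`, WIDTH SEAT `pub-ymgap-dag-n15-w2` (director-ym №197 ∕ HUMAN RULING D-0149), generation 2, file 2.  `bears_on: R4∕N15 · K3⁷ SpineGivenEndpointR13SepCoPH
(stmt-QuantumFields-20544)`.  Filed `--kind proof --supports stmt-QuantumFields-20544 --as helper` — COUNT-NEUTRAL; theorems only (0 `def`, 0 `sorry`); imports BY NAME
this seat's file 1 `…N15CurvedTransporterOrthogonality` (p593011: `expTrField_mul_transpose_of_skew`, `expTrField_transpose_mul_of_skew`, `covShiftLetter_exp_of_skew`) and
dag-n15-w3's file 2 `…N15CurvedDressedPair` (p585823: `curvDressed`, `curvDressed_inverts`, `isUnit_curvDressed`, `hasMaj_curvDressed`, `hasMaj_curvDressed_sub`,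
`curvRowLetter`, `covPieces`); through them file 5 `transporterLetter_exp` (p589511) and file 1 `gaugePair`, `curvCoefA`, `curvCoefC` (p583814); nothing re-declared.

WHY.  dag-n15-w3's file 2 states Bałaban's Neumann device (3.63)–(3.65) AT A CURVED BASE POINT over two kinds of displayed hypotheses on the transporter fields `R`
(background) and `S` (perturbation): (i) the ORTHOGONALITY MODEL `SSᵀ = 1`, `RᵀR = RRᵀ = 1`; (ii) transporter-form letters `|S − 1| ≤ ηp`, `|S_μ − R₋ᵀS₋R₋| ≤ η²q`.
File 5 (p589511) discharged (ii) from (3.37)-shaped GENERATOR letters for the exponential species `S = expTrField e η Z`, `R = expTrField e η W` — except that its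
covariant-gradient letter still carried the orthogonal-model identification `hRt`; this seat's file 1 (p593011) discharged (i) and `hRt` from ONE algebraic hypothesis,
SKEWNESS of the generators' coordinate matrices (= coordinates orthonormal for an `ad`-invariant pairing; a theorem for quaternion-valued fields).  THIS FILE IS THE ONE
APPLICATION that puts the two together: file 2's four headline theorems for exponential data with NO orthogonality hypothesis and NO transporter-level letter — only
generator letters, regimes, skewness, and the curved-base-point data (`G(U)`'s (3.42)₀,₁-shaped majorants, carrier, Neumann smallness) that the lineage displays as the
inductive datum.

WHAT: `curvDressed_inverts_exp_of_skew` · `isUnit_curvDressed_exp_of_skew` · `hasMaj_curvDressed_exp_of_skew` · `hasMaj_curvDressed_sub_exp_of_skew` — each ONE term: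
file 2's theorem at `R := expTrField e η W`, `S := expTrField e η Z`, `p := κ_e·e·r`, `q := κ_e·(e·g + e²(2 + e)·r·r_B)`, with `hS`∕`hR'` := `expTrField_mul_transpose_of_skew`,
`hR` := `expTrField_transpose_mul_of_skew`, `hSp` := `transporterLetter_exp`, `hSq` := `covShiftLetter_exp_of_skew`.

HONEST FRAMING ∕ LIMITS.  A knit, no new estimate; Neumann-device bookkeeping over hypothesis-SHAPED data ([B9] (3.37) p. 396, (3.42) p. 397, (3.53) p. 400, (3.63)–(3.65)
pp. 402–403 = SHAPES ∕ MECHANISM; nothing of [B9] asserted); the curved-base-point majorants `hG`∕`hD`, the carrier and the smallness stay DISPLAYED; the η-DEFECT ∕ fit side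
(file 4, dag-n15-w3 g2's `…CurvedGradientFit` ∕ `…CurvedDressedPairDefectExp`) is NOT touched here; [B6] gluing NOT touched.  NE2⁺ NOT PRINTED ∕ NOT proved for d = 4; N15 NOT
discharged; K3⁷ OPEN, not claimed; counts UNMOVED (typed 28∕28 · discharged 5∕27, A 5∕28); one finite 𝕋⁴ at fixed ε — NOT infinite volume, NOT OS on ℝ⁴, NOT a mass gap,
NOT Clay; R4 closes the conditional finite-𝕋⁴ rung `BalabanLadder.UV` only.  Restate-immune (no Theses import).
-/

set_option autoImplicit false

noncomputable section
open scoped BigOperators Matrix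
open Finset NormedSpace

namespace Summit.QuantumFields.YangMills.BalabanUVNodes.N15.CurvedSpecies

open Summit.QuantumFields.YangMills.BalabanUVNodes.N15.MatrixSpecies (Phi0 coordMat basisConst basisConst_nonneg liftBlk)

section ExpData

open Literature.MathematicalPhysics.QuantumFieldTheory.Balaban1983to89
open Literature.MathematicalPhysics.QuantumFieldTheory.Balaban1983to89.B11SectG (BlockNorm HasMaj RowSum)
open Literature.MathematicalPhysics.QuantumFieldTheory.Balaban1983to89.B6RandomWalk (Triangle254)
open Summit.QuantumFields.YangMills.BalabanUVNodes.N15.BackgroundLayer (covLapM stack projO blkPair unstackM)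

variable {X ι J : Type} [Fintype X] [DecidableEq X] [Fintype ι] [DecidableEq ι] [Fintype J] [DecidableEq J]
  {𝔄 : Type} [NormedRing 𝔄] [NormedAlgebra ℝ 𝔄] [CompleteSpace 𝔄] (e : 𝔄 ≃L[ℝ] (ι → ℝ))
  (η : ℝ) (τ : J → X ≃ X) (Z W : J → X → (𝔄 →L[ℝ] 𝔄)) {g : B6.Geometry} (blk : X → g.Site) (G : (X × ι → ℝ) →ₗ[ℝ] (X × ι → ℝ)) {β δ σ cr : ℝ}

/-- ★ **THE RESOLVENT CERTIFICATE AT A CURVED BASE POINT FOR EXPONENTIAL DATA** (file 2 `curvDressed_inverts`, its orthogonality hypothesis `hR` SUPPLIED): background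
`R = expTrField e η W` with SKEW generators in coordinates, perturbation `S = expTrField e η Z` (no hypothesis on `Z`), `P` any remainder, `G` a left inverse of
`covLapM τ η (gaugePair τ R) + P`; under the Neumann unit the `pr₀`-component of the curved dressed pair inverts `covLapM τ η (gaugePair τ (S·R)) + P` on both sides.
[cite: Balaban1985BackgroundPropagators, (3.53) p.400, (3.63)–(3.65) pp.402–403 (mechanism)] -/
theorem curvDressed_inverts_exp_of_skew (hWskew : ∀ μ x, (coordMat e (W μ x))ᵀ = -coordMat e (W μ x)) {P : (X × ι → ℝ) →ₗ[ℝ] (X × ι → ℝ)}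
    (hG : (covLapM τ η (gaugePair τ (expTrField e η W)) + P) ∘ₗ G = LinearMap.id)
    (hunit : IsUnit (1 - LinearMap.toMatrix' (stack G (covPieces η τ (gaugePair τ (expTrField e η W)) G) ∘ₗ
      unstackM (curvCoefC η τ (expTrField e η W) (expTrField e η Z)) (curvCoefA η τ (expTrField e η W) (expTrField e η Z))))) :
    (covLapM τ η (gaugePair τ (fun μ x => expTrField e η Z μ x * expTrField e η W μ x)) + P) ∘ₗ
        (projO none ∘ₗ curvDressed η τ (expTrField e η W) (expTrField e η Z) G) = LinearMap.id ∧
      (projO none ∘ₗ curvDressed η τ (expTrField e η W) (expTrField e η Z) G) ∘ₗ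
        (covLapM τ η (gaugePair τ (fun μ x => expTrField e η Z μ x * expTrField e η W μ x)) + P) = LinearMap.id :=
  curvDressed_inverts η τ G (expTrField e η W) (expTrField e η Z) (expTrField_mul_transpose_of_skew e η W hWskew) hG hunit

/-- ★★ **THE DRESSED PAIR's MAJORANT FOR EXPONENTIAL DATA FROM GENERATOR LETTERS ONLY** (file 2 `hasMaj_curvDressed` with `hS`, `hR`, `hR'` SUPPLIED by p593011 and the
transporter letters READ OFF the generators: `p := κ_e·e·r` by file 5 `transporterLetter_exp`, `q := κ_e·(e·g + e²(2 + e)·r·r_B)` by `covShiftLetter_exp_of_skew`): for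
`‖Z_μ(x)‖ ≤ r`, `‖W_μ(x)‖ ≤ r_B`, `‖Z_μ(x) − Z_μ(x − e_μ)‖ ≤ ηg`, `0 < η`, `ηr ≤ 1`, `ηr_B ≤ 1`, SKEW `coordMat e (Z_μ(x))`, `coordMat e (W_μ(x))`, the (3.42)₀,₁-shaped
majorants of `G(U)` and of its covariant pieces at the curved `U` and the Neumann smallness, `X̂ ≤ β(1 − β·R_V·c_r)⁻¹·e^{−ρd}` with `R_V = r_V(p, q)(1 + |J ⊕ J|)`.
[cite: Balaban1985BackgroundPropagators, (3.37) p.396 (generator letters: shape), (3.64) p.403 (mechanism)] -/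
theorem hasMaj_curvDressed_exp_of_skew {r rB gZ ρ : ℝ} (htri : Triangle254 g) (hd : ∀ a b : g.Site, 0 ≤ g.dist a b) (hrow : RowSum g σ cr) (hσ : 0 ≤ σ)
    (hρ : 0 ≤ ρ) (hρδ : ρ + σ ≤ δ) (hβ : 0 ≤ β) (hη : 0 < η) (hr : 0 ≤ r) (hrB : 0 ≤ rB) (hgZ : 0 ≤ gZ) (hreg : η * r ≤ 1) (hregB : η * rB ≤ 1)
    (hZ : ∀ μ x, ‖Z μ x‖ ≤ r) (hW : ∀ μ x, ‖W μ x‖ ≤ rB) (hgrad : ∀ μ x, ‖Z μ x - Z μ ((τ μ).symm x)‖ ≤ η * gZ)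
    (hZskew : ∀ μ x, (coordMat e (Z μ x))ᵀ = -coordMat e (Z μ x)) (hWskew : ∀ μ x, (coordMat e (W μ x))ᵀ = -coordMat e (W μ x))
    (hG : HasMaj (BlockNorm.ofBlocks g (liftBlk blk ι)) (BlockNorm.ofBlocks g (liftBlk blk ι)) G (fun y y' => β * Real.exp (-(δ * g.dist y y'))))
    (hD : ∀ j, HasMaj (BlockNorm.ofBlocks g (liftBlk blk ι)) (BlockNorm.ofBlocks g (liftBlk blk ι)) (covPieces η τ (gaugePair τ (expTrField e η W)) G j)
      (fun y y' => β * Real.exp (-(δ * g.dist y y'))))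
    (hsmall : β * (curvRowLetter ι J (basisConst e * Real.exp 1 * r) (basisConst e * (Real.exp 1 * gZ + Real.exp 1 ^ 2 * (2 + Real.exp 1) * r * rB)) *
      (1 + Fintype.card (J ⊕ J))) * cr < 1) :
    HasMaj (BlockNorm.ofBlocks g (liftBlk blk ι)) (BlockNorm.ofBlocks g (blkPair (liftBlk blk ι))) (curvDressed η τ (expTrField e η W) (expTrField e η Z) G)
      (fun y y' => β * (1 - β * (curvRowLetter ι J (basisConst e * Real.exp 1 * r) (basisConst e * (Real.exp 1 * gZ + Real.exp 1 ^ 2 * (2 + Real.exp 1) * r * rB)) *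
        (1 + Fintype.card (J ⊕ J))) * cr)⁻¹ * Real.exp (-(ρ * g.dist y y'))) :=
  hasMaj_curvDressed η τ (expTrField e η W) (expTrField e η Z) blk G htri hd hrow hσ hρ hρδ hβ hη
    (by have := basisConst_nonneg e; positivity) (by have := basisConst_nonneg e; positivity)
    (expTrField_mul_transpose_of_skew e η Z hZskew) (expTrField_transpose_mul_of_skew e η W hWskew) (expTrField_mul_transpose_of_skew e η W hWskew)
    (fun μ x i j => transporterLetter_exp e η Z hη.le hreg hZ μ x i j)
    (fun μ x i j => covShiftLetter_exp_of_skew e η τ Z W hη.le hreg hregB hZ hW hgrad hWskew μ x i j) hG hD hsmall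

/-- **THE NEUMANN UNIT AT A CURVED BASE POINT FOR EXPONENTIAL DATA** (file 2 `isUnit_curvDressed`, orthogonality SUPPLIED, letters read off the generators).
[cite: Balaban1985BackgroundPropagators, (3.63)–(3.64) pp.402–403 (mechanism)] -/
theorem isUnit_curvDressed_exp_of_skew {r rB gZ : ℝ} (hd : ∀ a b : g.Site, 0 ≤ g.dist a b) (hrow : RowSum g σ cr) (hσδ : σ ≤ δ) (hβ : 0 ≤ β) (hη : 0 < η)
    (hr : 0 ≤ r) (hrB : 0 ≤ rB) (hgZ : 0 ≤ gZ) (hreg : η * r ≤ 1) (hregB : η * rB ≤ 1)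
    (hZ : ∀ μ x, ‖Z μ x‖ ≤ r) (hW : ∀ μ x, ‖W μ x‖ ≤ rB) (hgrad : ∀ μ x, ‖Z μ x - Z μ ((τ μ).symm x)‖ ≤ η * gZ)
    (hZskew : ∀ μ x, (coordMat e (Z μ x))ᵀ = -coordMat e (Z μ x)) (hWskew : ∀ μ x, (coordMat e (W μ x))ᵀ = -coordMat e (W μ x))
    (hG : HasMaj (BlockNorm.ofBlocks g (liftBlk blk ι)) (BlockNorm.ofBlocks g (liftBlk blk ι)) G (fun y y' => β * Real.exp (-(δ * g.dist y y'))))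
    (hD : ∀ j, HasMaj (BlockNorm.ofBlocks g (liftBlk blk ι)) (BlockNorm.ofBlocks g (liftBlk blk ι)) (covPieces η τ (gaugePair τ (expTrField e η W)) G j)
      (fun y y' => β * Real.exp (-(δ * g.dist y y'))))
    (hsmall : β * (curvRowLetter ι J (basisConst e * Real.exp 1 * r) (basisConst e * (Real.exp 1 * gZ + Real.exp 1 ^ 2 * (2 + Real.exp 1) * r * rB)) *
      (1 + Fintype.card (J ⊕ J))) * cr < 1) :
    IsUnit (1 - LinearMap.toMatrix' (stack G (covPieces η τ (gaugePair τ (expTrField e η W)) G) ∘ₗ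
      unstackM (curvCoefC η τ (expTrField e η W) (expTrField e η Z)) (curvCoefA η τ (expTrField e η W) (expTrField e η Z)))) :=
  isUnit_curvDressed η τ (expTrField e η W) (expTrField e η Z) blk G hd hrow hσδ hβ hη
    (by have := basisConst_nonneg e; positivity) (by have := basisConst_nonneg e; positivity)
    (expTrField_mul_transpose_of_skew e η Z hZskew) (expTrField_transpose_mul_of_skew e η W hWskew) (expTrField_mul_transpose_of_skew e η W hWskew)
    (fun μ x i j => transporterLetter_exp e η Z hη.le hreg hZ μ x i j)
    (fun μ x i j => covShiftLetter_exp_of_skew e η τ Z W hη.le hreg hregB hZ hW hgrad hWskew μ x i j) hG hD hsmall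

/-- ★★ **THE BACKGROUND-LIPSCHITZ INCREMENT AT A CURVED BASE POINT FOR EXPONENTIAL DATA** (file 2 `hasMaj_curvDressed_sub`, orthogonality SUPPLIED, letters read off
the generators): `pr₀X̂ − G(U) ≤ β·R_V·β(1 − β·R_V·c_r)⁻¹·c_r·e^{−ρd}`, `R_V = r_V(κ_e e r, κ_e(e g + e²(2+e) r r_B))(1 + |J ⊕ J|)` — NE2-LIP at a curved `U` for Bałaban's
exponential species with no model hypothesis beyond skewness of the generators' coordinates (§4∕§5 of p593011: orthonormal coordinates for an ad-invariant pairing;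
automatic for quaternion-valued fields). [cite: Balaban1985BackgroundPropagators, (3.63)–(3.65) pp.402–403 (mechanism), Thm 3.4 p.400] -/
theorem hasMaj_curvDressed_sub_exp_of_skew {r rB gZ ρ : ℝ} (htri : Triangle254 g) (hd : ∀ a b : g.Site, 0 ≤ g.dist a b) (hrow : RowSum g σ cr) (hσ : 0 ≤ σ)
    (hρ : 0 ≤ ρ) (hρδ : ρ + σ ≤ δ) (hβ : 0 ≤ β) (hη : 0 < η) (hr : 0 ≤ r) (hrB : 0 ≤ rB) (hgZ : 0 ≤ gZ) (hreg : η * r ≤ 1) (hregB : η * rB ≤ 1)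
    (hZ : ∀ μ x, ‖Z μ x‖ ≤ r) (hW : ∀ μ x, ‖W μ x‖ ≤ rB) (hgrad : ∀ μ x, ‖Z μ x - Z μ ((τ μ).symm x)‖ ≤ η * gZ)
    (hZskew : ∀ μ x, (coordMat e (Z μ x))ᵀ = -coordMat e (Z μ x)) (hWskew : ∀ μ x, (coordMat e (W μ x))ᵀ = -coordMat e (W μ x))
    (hG : HasMaj (BlockNorm.ofBlocks g (liftBlk blk ι)) (BlockNorm.ofBlocks g (liftBlk blk ι)) G (fun y y' => β * Real.exp (-(δ * g.dist y y'))))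
    (hD : ∀ j, HasMaj (BlockNorm.ofBlocks g (liftBlk blk ι)) (BlockNorm.ofBlocks g (liftBlk blk ι)) (covPieces η τ (gaugePair τ (expTrField e η W)) G j)
      (fun y y' => β * Real.exp (-(δ * g.dist y y'))))
    (hsmall : β * (curvRowLetter ι J (basisConst e * Real.exp 1 * r) (basisConst e * (Real.exp 1 * gZ + Real.exp 1 ^ 2 * (2 + Real.exp 1) * r * rB)) *
      (1 + Fintype.card (J ⊕ J))) * cr < 1) :
    HasMaj (BlockNorm.ofBlocks g (liftBlk blk ι)) (BlockNorm.ofBlocks g (liftBlk blk ι)) (projO none ∘ₗ curvDressed η τ (expTrField e η W) (expTrField e η Z) G - G)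
      (fun y y' => β * ((curvRowLetter ι J (basisConst e * Real.exp 1 * r) (basisConst e * (Real.exp 1 * gZ + Real.exp 1 ^ 2 * (2 + Real.exp 1) * r * rB)) *
        (1 + Fintype.card (J ⊕ J))) * (β * (1 - β * (curvRowLetter ι J (basisConst e * Real.exp 1 * r)
          (basisConst e * (Real.exp 1 * gZ + Real.exp 1 ^ 2 * (2 + Real.exp 1) * r * rB)) * (1 + Fintype.card (J ⊕ J))) * cr)⁻¹)) * cr *
        Real.exp (-(ρ * g.dist y y'))) :=
  hasMaj_curvDressed_sub η τ (expTrField e η W) (expTrField e η Z) blk G htri hd hrow hσ hρ hρδ hβ hη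
    (by have := basisConst_nonneg e; positivity) (by have := basisConst_nonneg e; positivity)
    (expTrField_mul_transpose_of_skew e η Z hZskew) (expTrField_transpose_mul_of_skew e η W hWskew) (expTrField_mul_transpose_of_skew e η W hWskew)
    (fun μ x i j => transporterLetter_exp e η Z hη.le hreg hZ μ x i j)
    (fun μ x i j => covShiftLetter_exp_of_skew e η τ Z W hη.le hreg hregB hZ hW hgrad hWskew μ x i j) hG hD hsmall

end ExpData

end Summit.QuantumFields.YangMills.BalabanUVNodes.N15.CurvedSpecies

end
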